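import Literature.NumberTheory.LFunctions.AnalyticRanksLandauSiegel
import Literature.NumberTheory.LFunctions.RealZeroEffectiveRepulsionExplicit
import Literature.Barriers.Parity.SiegelZeroDichotomyProofs
import HarnessLib

/-!
# A Siegel zero of quality `> 55 (log D)^{51}` puts Bui–Pratt–Zaharescu's dichotomy in its
# «illusory» branch: analytic ranks of `J₀(q)` concentrate at `½·dim` (PROVED only; debt 0)

Topic `Literature/NumberTheory/LFunctions`. Typed for the cell `parity-realchar` (SIEGEL INSTRUMENT,
deliverable (3) «illusory-world conditionals», topic I.9 «central values and analytic ranks under an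
exceptional character»). The named fact is the tree's `buiPrattZaharescu2024_theorem11`
(Bui–Pratt–Zaharescu, J. London Math. Soc. 109 (2024), Theorem 1.1, typed by the cell
`landau-siegel` in `AnalyticRanksLandauSiegel.lean`): for `D` large and `ψ` real odd primitive mod
`D`, EITHER (A) `L(1,ψ) ≥ (log D)^{−50}` OR (B) for every prime `q ∈ [D^{750}, D^C]` the analytic rank
of `J₀(q)` is `(½ + O(√(log₃q/log₂q)))·dim` (`ψ(q) = 1`) resp. between `(½ − O(log₃q/log₂q))·dim` and
`(1 + O(√(log₃q/log₂q)))·dim` (`ψ(q) = −1`).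

The hypothesis of that dichotomy's branch (B) is stated on the `L(1)` side. This file PROVES that
the column's zero-side predicate triggers it: by the tree's explicit Montgomery–Vaughan (11.10)
(`RealZeroRepulsion.isSiegelZero_eta_le`: a Siegel zero of quality `η` at `D ≥ 8` gives
`‖L(1,ψ)‖ log D ≤ 55 (log D)²/η`), a Siegel zero of quality `η > 55 (log D)^{51}` forces
`‖L(1,ψ)‖ < (log D)^{−50}`, i.e. NOT (A); hence

* `IsSiegelZero.norm_LFunction_one_lt_of_quality_gt` — quality `η > 55 (log D)^{A+1}` ⇒
  `‖L(1,ψ)‖ < (log D)^{−A}` (`D ≥ 8`, any real `A`): the zero-side ⇒ `L(1)`-side strength dictionary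
  in the direction needed here;
* **`IsSiegelZero.analyticRanks_of_bpz`** — modulo `buiPrattZaharescu2024_theorem11`: for every
  `C ≥ 750` there are `K > 0` and `D₀` such that every Siegel zero of quality `η > 55 (log D)^{51}`
  attached to an ODD primitive quadratic `ψ` mod `D ≥ D₀` yields branch (B) for all primes
  `q ∈ [D^{750}, D^C]` — the «illusory world» face of topic I.9 on `IsSiegelZero`.

By `ExceptionalCharacterConductorFloor.lean` (`not_strength_fifty_of_le_exp`) no such character
exists with `D ≤ e^{600}`: the reading is void below `e^{600}` (kernel), as it must be.

LABEL (cell rule): instrument / statement-layer glue. WHAT THIS IS NOT: no claim that such a Siegel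
zero exists; the rank statement is the source's ANALYTIC rank of `L(J₀(q), s)` (no BSD, no
Mordell–Weil); nothing here bears on the parity summit.

## References

* [BuiPrattZaharescu2023] H. M. Bui, K. Pratt, A. Zaharescu, *Analytic ranks of automorphic
  L-functions and Landau–Siegel zeros*, J. London Math. Soc. (2) 109 (2024) — Theorem 1.1 (tree:
  `buiPrattZaharescu2024_theorem11`).
* [MontgomeryVaughan2007] Theorem 11.4 (11.10) — tree: `RealZeroRepulsion.isSiegelZero_eta_le`.
* [TaoTeravainen2021] Definition 1.4 (quality `η`).
-/

noncomputable section

open Literature.Barriers.Parity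

namespace Literature.NumberTheory.LFunctions

open BPZ2024

/-- **Zero-side ⇒ `L(1)`-side strength**: a Siegel zero of quality `η > 55 (log D)^{A+1}` attached to
`χ` mod `D ≥ 8` gives `‖L(1,χ)‖ < (log D)^{−A}` (from `‖L(1,χ)‖ log D ≤ 55 (log D)²/η`).
[cite: MontgomeryVaughan2007, Theorem 11.4 (11.10)] [cite: TaoTeravainen2021, Definition 1.4] -/
theorem _root_.Literature.Barriers.Parity.IsSiegelZero.norm_LFunction_one_lt_of_quality_gt
    {D : ℕ} [NeZero D] (hD : 8 ≤ D) {χ : DirichletCharacter ℂ D} {η A : ℝ} (hS : IsSiegelZero χ η)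
    (hη : 55 * Real.log D ^ (A + 1) < η) : ‖χ.LFunction 1‖ < Real.log D ^ (-A) := by
  have h := RealZeroRepulsion.isSiegelZero_eta_le hD hS
  have hD1 : (1 : ℝ) < D := by exact_mod_cast (show 1 < D by omega)
  have hlog : 0 < Real.log D := Real.log_pos hD1
  have hηpos : 0 < η := by linarith [hS.ten_le]
  -- `‖L‖ ≤ 55 log D / η < (log D)^{-A}` iff `55 (log D)^{1+A} < η`
  have h1 : ‖χ.LFunction 1‖ ≤ 55 * Real.log D / η := by
    rw [le_div_iff₀ hηpos]
    rw [le_div_iff₀ hηpos] at h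
    have : ‖χ.LFunction 1‖ * η * Real.log D ≤ 55 * Real.log D * Real.log D := by nlinarith
    exact le_of_mul_le_mul_right this hlog
  have hsplit : Real.log D ^ (A + 1) = Real.log D ^ A * Real.log D := by
    rw [Real.rpow_add hlog, Real.rpow_one]
  have hpowA : 0 < Real.log D ^ A := Real.rpow_pos_of_pos hlog A
  have h2 : 55 * Real.log D / η < Real.log D ^ (-A) := by
    rw [div_lt_iff₀ hηpos, Real.rpow_neg hlog.le]
    -- `55 log D < (log D)^{-A} η`; from `55 (log D)^A log D < η` divide by `(log D)^A`
    rw [hsplit] at hη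
    have : 55 * Real.log D * Real.log D ^ A < η := by linarith
    calc 55 * Real.log D = 55 * Real.log D * Real.log D ^ A * (Real.log D ^ A)⁻¹ := by
          field_simp
      _ < η * (Real.log D ^ A)⁻¹ := by
          exact mul_lt_mul_of_pos_right this (inv_pos.mpr hpowA)
      _ = (Real.log D ^ A)⁻¹ * η := by ring
  exact lt_of_le_of_lt h1 h2

/-- **A Siegel zero of quality `> 55 (log D)^{51}` at an odd character forces Bui–Pratt–Zaharescu's
branch (B)** (READING of Theorem 1.1 modulo the named fact `buiPrattZaharescu2024_theorem11`): for
every `C ≥ 750` there are `K > 0` and `D₀` such that for every `D ≥ D₀`, every ODD primitive quadratic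
`ψ` mod `D` carrying a Siegel zero of quality `η > 55 (log D)^{51}`, and every prime `q` with
`D^{750} ≤ q ≤ D^C`: if `ψ(q) = 1` then `|rank J₀(q) − dim/2| ≤ K √(log₃q/log₂q)·dim`, and if
`ψ(q) = −1` then `(½ − K log₃q/log₂q)·dim ≤ rank J₀(q) ≤ (1 + K √(log₃q/log₂q))·dim` (analytic rank,
`BPZ2024.analyticRankJ0`; `dim = BPZ2024.dimJ0`).
[cite: BuiPrattZaharescu2023, §1 Theorem 1.1] [cite: MontgomeryVaughan2007, Theorem 11.4 (11.10)]
[cite: TaoTeravainen2021, Definition 1.4] -/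
theorem _root_.Literature.Barriers.Parity.IsSiegelZero.analyticRanks_of_bpz
    (h : buiPrattZaharescu2024_theorem11) {C : ℝ} (hC : 750 ≤ C) :
    ∃ K : ℝ, 0 < K ∧ ∃ D₀ : ℕ, ∀ (D : ℕ) [NeZero D], D₀ ≤ D →
      ∀ (ψ : DirichletCharacter ℂ D) (η : ℝ), IsSiegelZero ψ η → ψ.Odd →
        55 * Real.log D ^ (51 : ℝ) < η →
        ∀ (q : ℕ) [NeZero q], q.Prime → (D : ℝ) ^ (750 : ℝ) ≤ (q : ℝ) → (q : ℝ) ≤ (D : ℝ) ^ C →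
          (ψ (q : ZMod D) = 1 →
            |(analyticRankJ0 q : ℝ) - (dimJ0 q : ℝ) / 2| ≤
              K * Real.sqrt (Real.log (Real.log (Real.log q)) / Real.log (Real.log q)) * dimJ0 q) ∧
          (ψ (q : ZMod D) = -1 →
            (1 / 2 - K * (Real.log (Real.log (Real.log q)) / Real.log (Real.log q))) * dimJ0 q ≤
                analyticRankJ0 q ∧
              (analyticRankJ0 q : ℝ) ≤
                (1 + K * Real.sqrt (Real.log (Real.log (Real.log q)) / Real.log (Real.log q))) *
                  dimJ0 q) := by
  obtain ⟨K, hK, D₀, hmain⟩ := h C hC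
  refine ⟨K, hK, max D₀ 8, fun D _ hD ψ η hS hodd hη q _ hq hlo hhi => ?_⟩
  have hD₀ : D₀ ≤ D := le_trans (le_max_left _ _) hD
  have hD8 : 8 ≤ D := le_trans (le_max_right _ _) hD
  have hη' : 55 * Real.log D ^ ((50 : ℝ) + 1) < η := by
    rw [show (50 : ℝ) + 1 = 51 by norm_num]; exact hη
  have hlt : ‖ψ.LFunction 1‖ < Real.log D ^ (-(50 : ℝ)) :=
    hS.norm_LFunction_one_lt_of_quality_gt hD8 (A := 50) hη'
  rcases hmain D hD₀ ψ hS.1 hS.2.1 hodd with hA | hB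
  · exact absurd hA (not_le.mpr hlt)
  · exact hB q hq hlo hhi

end Literature.NumberTheory.LFunctions

end
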